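import Literature.ModelTheory.Quasiminimal.ContinuumModel
import HarnessLib

/-!
# Exponential fields of every infinite cardinality from a countable quasiminimal one

Let `S : Setup L M cl` be the data of `ContinuumModel.lean`: a countable exponential field `M`
carrying a weakly quasiminimal pregeometry structure (language `L`, closure `cl`) with a basis
`b : ℕ ⊕ (ℕ ⊕ ℕ) → M`, whose everywhere-defined partial self-embeddings are E-ring
endomorphisms. `ContinuumModel.lean` forms the direct limit of the charts `M` along the
functorial system of closed self-embeddings indexed by the finite subsets of `ℝ`
(`SelfEmbeddings.lean`) and obtains an exponential field of cardinality exactly `𝔠`.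

Here the same construction is carried out over the finite subsets of an **arbitrary linear
order `I`** (a type in `Type`, so that the model stays in `Type`): the direct limit
`S.Model I` is an exponential field into which every chart `M` embeds as an E-subfield
(`S.chart I X`), and

* `#(S.Model I) = #I` as soon as `I` is infinite (`Setup.mk_model`): at most
  `#(Finset I) · #M = #I`, and at least `#I` because the separated element `v` has pairwise
  distinct images `[v]_{{s}}`, `s ∈ I`;
* `S.Model I` is of characteristic zero / algebraically closed / has surjective exponential /
  has the kernel of `M` as soon as `M` does (`Setup.isAlgClosed_model`,
  `Setup.isSurjectiveOntoUnits_model`, `Setup.mem_expKernel_model_iff`,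
  `Setup.expKernel_model_eq`).

This is the existence half of "a quasiminimal (excellent) class has exactly one model of every
cardinal dimension", in the form "the limit along a linear order of cardinality `κ ≥ ℵ₀` of the
directed system of closed self-embeddings of the countable model has cardinality `κ`"
(Kirby 2010, Thm 4.2: the chain `(M_μ)` with bases indexed by the ordinals `μ`; Bays–Hart–
Hyttinen–Kesälä–Kirby 2014, Thm 2.3, existence; Zilber 2005, §5, for pseudo-exponentiation),
specialised to exponential fields. Taking `I = κ.ord.ToType` gives a model of any prescribed
infinite cardinality `κ` (`KappaAxioms.lean`, `Setup.exists_kappaModel_over_base`); `I = ℝ`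
recovers `ContinuumModel.lean`: the definitions below are the same terms with `ℝ` generalised,
so that `S.Model ℝ = S.F` holds by `rfl` (`Setup.model_real_eq_F`) and that file's statements
are the instances `I = ℝ` of the ones here (it is kept as is because it has users). Only the
structure `Setup` and generic lemmas are used from it.

## Main statements

* `Setup.Model I`, `Setup.chart I X`, `Setup.baseEmb I ιM` — the model, its charts, the base.
* `Setup.mk_model` — `#(S.Model I) = #I` for infinite `I`.
* `Setup.isAlgClosed_model`, `Setup.isSurjectiveOntoUnits_model`, `Setup.expKernel_model_eq`,
  `Setup.exp_baseEmb` — the ELA axioms, the kernel and the base exponential transfer.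

## References

* J. Kirby, *On quasiminimal excellent classes*, J. Symbolic Logic 75 (2010), Thm 4.2.
* M. Bays, B. Hart, T. Hyttinen, M. Kesälä, J. Kirby, *Quasiminimal structures and excellence*,
  Bull. LMS 46 (2014), Thm 2.3.
* B. Zilber, *Pseudo-exponentiation on algebraically closed fields of characteristic zero*,
  Ann. Pure Appl. Logic 132 (2005), §5.
-/

noncomputable section

suppress_compilation

open Set FirstOrder FirstOrder.Language Cardinal
open Literature.ModelTheory.ExponentialFields

namespace Literature.ModelTheory.Quasiminimal

namespace Setup

variable {L : Language.{0, 0}} {M : Type} [L.Structure M] [Field M] [ExponentialRing M]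
  {cl : Set M → Set M} (S : Setup L M cl) (I : Type) [LinearOrder I]

/-- The system of closed self-embeddings of `M` over the finite subsets of `I` (chosen).
[cite: Kirby2010QMEC, Thm 4.2] -/
def sys : Finset I → Finset I → M → M :=
  haveI := S.countable
  Classical.choose (S.isWQPS.exists_selfEmbeddingSystem S.indep S.span I)

/-- The defining properties of the chosen system `sys`. [cite: Kirby2010QMEC, Thm 4.2] -/
theorem sys_spec :
    (∀ X : Finset I, S.sys I X X = id) ∧
    (∀ X Y Z : Finset I, X ⊆ Y → Y ⊆ Z → S.sys I Y Z ∘ S.sys I X Y = S.sys I X Z) ∧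
    (∀ X Y : Finset I, X ⊆ Y → IsQFEmbOn L (S.sys I X Y) Set.univ) ∧
    (∀ X Y : Finset I, X ⊆ Y → cl (range (S.sys I X Y)) = range (S.sys I X Y)) ∧
    ∃ v : M, ∀ s t : I, s < t → S.sys I {s} {s, t} v ≠ S.sys I {t} {s, t} v :=
  haveI := S.countable
  Classical.choose_spec (S.isWQPS.exists_selfEmbeddingSystem S.indep S.span I)

variable {I}

/-- `sys X X = id`. [folklore] -/
theorem sys_self (X : Finset I) : S.sys I X X = id := (S.sys_spec I).1 X

/-- Functoriality of the system. [folklore] -/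
theorem sys_comp {X Y Z : Finset I} (hXY : X ⊆ Y) (hYZ : Y ⊆ Z) :
    S.sys I Y Z ∘ S.sys I X Y = S.sys I X Z := (S.sys_spec I).2.1 X Y Z hXY hYZ

/-- Each `sys X Y` is a partial embedding on all of `M`. [folklore] -/
theorem sys_isQFEmbOn {X Y : Finset I} (hXY : X ⊆ Y) : IsQFEmbOn L (S.sys I X Y) Set.univ :=
  (S.sys_spec I).2.2.1 X Y hXY

/-- Each `sys X Y` has closed range. [folklore] -/
theorem cl_range_sys {X Y : Finset I} (hXY : X ⊆ Y) :
    cl (range (S.sys I X Y)) = range (S.sys I X Y) :=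
  (S.sys_spec I).2.2.2.1 X Y hXY

variable (I) in
/-- The system separates a point. [folklore] -/
theorem exists_separated_sys :
    ∃ v : M, ∀ s t : I, s < t → S.sys I {s} {s, t} v ≠ S.sys I {t} {s, t} v :=
  (S.sys_spec I).2.2.2.2

/-- The maps of the system as E-ring endomorphisms (chosen). [folklore] -/
def sysHom (X Y : Finset I) (h : X ≤ Y) : ExponentialRingHom M M :=
  Classical.choose (S.hom_of_isQFEmbOn _ (S.sys_isQFEmbOn h))

/-- The underlying function of `sysHom X Y h` is `sys X Y`. [folklore] -/
@[simp] theorem coe_sysHom {X Y : Finset I} (h : X ≤ Y) : ⇑(S.sysHom X Y h) = S.sys I X Y :=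
  Classical.choose_spec (S.hom_of_isQFEmbOn _ (S.sys_isQFEmbOn h))

/-- The system of E-ring endomorphisms is a directed system. [folklore] -/
instance directedSystem_sysHom : DirectedSystem (fun _ : Finset I => M)
    fun X Y h => ⇑(ExpDirectLimit.ringHoms (G := fun _ => M) S.sysHom X Y h) where
  map_self X x := by
    change S.sysHom X X le_rfl x = x
    rw [coe_sysHom, sys_self]; rfl
  map_map {Z Y X} hXY hYZ x := by
    change S.sysHom Y Z hYZ (S.sysHom X Y hXY x) = S.sysHom X Z _ x
    rw [coe_sysHom, coe_sysHom, coe_sysHom, ← S.sys_comp hXY hYZ]; rfl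

variable (I) in
/-- **The model over `I`**: the direct limit of the charts `M` along `sys`.
[cite: Kirby2010QMEC, Thm 4.2] -/
abbrev Model : Type := ExpDirectLimit.Lim (G := fun _ : Finset I => M) S.sysHom

variable (I) in
/-- The chart embeddings into the model over `I`. [folklore] -/
abbrev chart (X : Finset I) : M →+* S.Model I :=
  ExpDirectLimit.of (G := fun _ : Finset I => M) S.sysHom X

/-- Chart embeddings are injective. [folklore] -/
theorem chart_injective (X : Finset I) : Function.Injective (S.chart I X) :=
  ExpDirectLimit.of_injective' S.sysHom X

/-- Moving a chart preimage to a bigger chart. [folklore] -/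
theorem chart_sys {Z W : Finset I} (h : Z ⊆ W) (m : M) :
    S.chart I W (S.sys I Z W m) = S.chart I Z m := by
  rw [← S.coe_sysHom h]; exact ExpDirectLimit.of_φ S.sysHom h m

/-- Distinct indices give distinct elements `[v]_{{s}}` of the limit. [folklore] -/
theorem chart_singleton_ne {v : M}
    (hv : ∀ s t : I, s < t → S.sys I {s} {s, t} v ≠ S.sys I {t} {s, t} v)
    {s t : I} (hst : s < t) : S.chart I {s} v ≠ S.chart I {t} v := by
  have hs : ({s} : Finset I) ⊆ {s, t} := by simp
  have ht : ({t} : Finset I) ⊆ {s, t} := by simp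
  rw [← S.chart_sys hs v, ← S.chart_sys ht v]
  exact fun h => hv s t hst (S.chart_injective _ h)

variable (I) in
/-- **The model over an infinite linear order `I` has cardinality exactly `#I`** (Kirby 2010,
Thm 4.2; BHHKK 2014, Thm 2.3, existence: the model of dimension `κ` has cardinality `κ` for
`κ ≥ ℵ₀`). [cite: Kirby2010QMEC, Thm 4.2] -/
theorem mk_model [Infinite I] : #(S.Model I) = #I := by
  haveI := S.countable
  apply le_antisymm
  · refine (ExpDirectLimit.mk_le_of_const (ι := Finset I) S.sysHom).trans ?_
    rw [Cardinal.mk_finset_of_infinite]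
    calc #I * #M ≤ #I * ℵ₀ := mul_le_mul' le_rfl Cardinal.mk_le_aleph0
      _ = #I := Cardinal.mul_aleph0_eq (Cardinal.aleph0_le_mk I)
  · obtain ⟨v, hv⟩ := S.exists_separated_sys I
    refine Cardinal.mk_le_of_injective (f := fun s : I => S.chart I {s} v) fun s t hst => ?_
    by_contra hne
    rcases lt_or_gt_of_ne hne with hlt | hgt
    · exact S.chart_singleton_ne hv hlt hst
    · exact S.chart_singleton_ne hv hgt hst.symm

/-- Characteristic zero, as an instance on `S.Model I`. [folklore] -/
instance instCharZeroModel [CharZero M] : CharZero (S.Model I) := ExpDirectLimit.charZero S.sysHom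

variable (I) in
/-- Algebraic closedness transfers. [folklore] -/
theorem isAlgClosed_model [IsAlgClosed M] : IsAlgClosed (S.Model I) :=
  ExpDirectLimit.isAlgClosed S.sysHom

variable (I) in
/-- Surjectivity of `exp` transfers. [folklore] -/
theorem isSurjectiveOntoUnits_model (h : ExponentialRing.IsSurjectiveOntoUnits M) :
    ExponentialRing.IsSurjectiveOntoUnits (S.Model I) :=
  ExpDirectLimit.isSurjectiveOntoUnits S.sysHom fun _ => h

/-- `exp` on the charts. [folklore] -/
theorem exp_chart (X : Finset I) (x : M) :
    ExponentialRing.exp (S.chart I X x) = S.chart I X (ExponentialRing.exp x) :=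
  ExpDirectLimit.exp_of S.sysHom X x

/-- The kernel of the model. [folklore] -/
theorem mem_expKernel_model_iff (z : S.Model I) :
    z ∈ ExponentialRing.expKernel (S.Model I) ↔
      ∃ (X : Finset I) (x : M), x ∈ ExponentialRing.expKernel M ∧ S.chart I X x = z :=
  ExpDirectLimit.mem_expKernel_iff S.sysHom z

/-- Elements fixed by every `sys X Y` have chart-independent image in the model. [folklore] -/
theorem chart_eq_chart_of_fixed {x : M} (hx : ∀ X Y : Finset I, X ⊆ Y → S.sys I X Y x = x)
    (X Y : Finset I) : S.chart I X x = S.chart I Y x := by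
  have hX : X ≤ X ∪ Y := Finset.subset_union_left
  have hY : Y ≤ X ∪ Y := Finset.subset_union_right
  rw [← ExpDirectLimit.of_φ S.sysHom hX x, ← ExpDirectLimit.of_φ S.sysHom hY x]
  change S.chart I (X ∪ Y) (S.sysHom X (X ∪ Y) hX x) = S.chart I (X ∪ Y) (S.sysHom Y (X ∪ Y) hY x)
  rw [coe_sysHom, coe_sysHom, hx X _ hX, hx Y _ hY]

/-- Every finitely indexed family in the model comes from one chart. [folklore] -/
theorem exists_chart_family_model {ι : Type} [Fintype ι] (x : ι → S.Model I) :
    ∃ (W : Finset I) (xt : ι → M), S.chart I W ∘ xt = x := by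
  classical
  choose Z m hm using fun i => ExpDirectLimit.exists_of S.sysHom (x i)
  refine ⟨Finset.univ.sup Z, fun i => S.sys I (Z i) (Finset.univ.sup Z) (m i), funext fun i => ?_⟩
  rw [Function.comp_apply, S.chart_sys (Finset.le_sup (Finset.mem_univ i)), hm]

/-- Every finite subset of the model comes from one chart. [folklore] -/
theorem exists_chart_finset_model (s : Finset (S.Model I)) :
    ∃ (W : Finset I) (t : Finset M), (s : Set (S.Model I)) = S.chart I W '' ↑t := by
  classical
  choose Z m hm using fun a : S.Model I => ExpDirectLimit.exists_of S.sysHom a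
  refine ⟨s.sup Z, s.image fun a => S.sys I (Z a) (s.sup Z) (m a), ?_⟩
  ext y
  simp only [Finset.coe_image, mem_image, Finset.mem_coe]
  constructor
  · intro hy
    exact ⟨_, ⟨y, hy, rfl⟩, by rw [S.chart_sys (Finset.le_sup hy), hm]⟩
  · rintro ⟨_, ⟨a, ha, rfl⟩, rfl⟩
    rw [S.chart_sys (Finset.le_sup ha), hm]
    exact ha

/-- Images of closed sets under `sys` are closed: `sys[cl X] = cl (sys[X])`. [folklore] -/
theorem image_cl_sys {Z W : Finset I} (h : Z ⊆ W) (X : Set M) :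
    S.sys I Z W '' cl X = cl (S.sys I Z W '' X) := by
  have hP := S.isWQPS.isPregeometry
  refine (S.sys_isQFEmbOn h).image_cl_eq S.isWQPS (subset_univ _) ?_
  rw [image_univ, ← S.cl_range_sys h]
  exact hP.mono (image_subset_range _ _)

/-- The continuum model of `ContinuumModel.lean` is the model over `I = ℝ` (definitionally: the
definitions above are the same terms with `ℝ` generalised to `I`). [folklore] -/
theorem model_real_eq_F : S.Model ℝ = S.F := rfl

/-- In particular `ContinuumModel.lean`'s cardinality computation is the case `I = ℝ` of
`mk_model`. [cite: Kirby2010QMEC, Thm 4.2] -/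
theorem mk_model_real : #(S.Model ℝ) = 𝔠 := by
  rw [S.mk_model ℝ, Cardinal.mk_real]

/-! ### The base field inside the model -/

section Base

variable {K : Type} [Field K] (ιM : K →+* M)
  (hfix : ∀ σ : M → M, IsQFEmbOn L σ Set.univ → ∀ k, σ (ιM k) = ιM k)

variable (I) in
/-- The base embedding into the model (through the chart `∅`). [folklore] -/
def baseEmb : K →+* S.Model I := (S.chart I ∅).comp ιM

include hfix in
/-- Every chart embeds the base in the same way. [folklore] -/
theorem chart_ιM (X : Finset I) (k : K) : S.chart I X (ιM k) = S.baseEmb I ιM k := by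
  change S.chart I X (ιM k) = S.chart I ∅ (ιM k)
  exact S.chart_eq_chart_of_fixed (fun X Y hXY => hfix _ (S.sys_isQFEmbOn hXY) k) X ∅

/-- The exponential of the model extends the partial exponential of the base when that of `M`
does. [folklore] -/
theorem exp_baseEmb {D : Set K} {θ : K → K}
    (h : ∀ x ∈ D, ExponentialRing.exp (ιM x) = ιM (θ x)) :
    ∀ x ∈ D, ExponentialRing.exp (S.baseEmb I ιM x) = S.baseEmb I ιM (θ x) := by
  intro x hx
  change ExponentialRing.exp (S.chart I ∅ (ιM x)) = S.chart I ∅ (ιM (θ x))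
  rw [S.exp_chart, h x hx]

include hfix in
/-- The kernel of the model is that of `M` (read in any chart): if `ker exp_M = ℤ · ιM τ` then
`ker exp = ℤ · baseEmb τ` in the model. [folklore] -/
theorem expKernel_model_eq {τ : K}
    (hker : ExponentialRing.expKernel M = AddSubgroup.zmultiples (ιM τ)) :
    ExponentialRing.expKernel (S.Model I) = AddSubgroup.zmultiples (S.baseEmb I ιM τ) := by
  ext z
  rw [S.mem_expKernel_model_iff, AddSubgroup.mem_zmultiples_iff]
  constructor
  · rintro ⟨X, x, hx, rfl⟩
    rw [hker, AddSubgroup.mem_zmultiples_iff] at hx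
    obtain ⟨m, rfl⟩ := hx
    exact ⟨m, by rw [map_zsmul, S.chart_ιM ιM hfix X τ]⟩
  · rintro ⟨m, rfl⟩
    refine ⟨∅, m • ιM τ, ?_, ?_⟩
    · rw [hker]; exact AddSubgroup.zsmul_mem _ (AddSubgroup.mem_zmultiples _) m
    · rw [map_zsmul]; rfl

end Base

end Setup

end Literature.ModelTheory.Quasiminimal

end
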